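import Mathlib

/-!
# Secular identities for a rank-one update of a symmetric operator

Topic `Literature/Analysis/InnerProduct` (companion of `RankOneInterlacing`, `RankOneInertia`).
Let `T` be a symmetric operator on a real inner product space, `v` a vector, `μ : ℝ` a weight, and
suppose `u` is an eigenvector of the rank-one update `T + μ |v⟩⟨v|`:

  `T u + (μ ⟪v, u⟫) • v = ε • u`.

If `φ` is an eigenvector of `T`, `T φ = E • φ`, pairing the eigen-equation with `φ` and using the
symmetry of `T` gives the SECULAR IDENTITY

  `(E − ε) ⟪φ, u⟫ = −μ ⟪v, u⟫ ⟪φ, v⟫`,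

i.e. in an orthonormal eigenbasis of `T` the update eigenvector is a multiple of `(T − ε)⁻¹ v`
whenever `μ ⟪v, u⟫ ≠ 0` — Golub–Van Loan, *Matrix Computations* (4th ed.), §8.4.3, Theorem 8.4.3 (c)
and the first line of its proof, `(D − λ I) v = −ρ (zᵀ v) z` [GolubVanLoan2013, Thm 8.4.3]. Recorded
consequences: the component of `v` along an eigenvector of `T` whose eigenvalue is pinned near `ε`
is small, `|⟪φ, v⟫| · |μ ⟪v, u⟫| ≤ |E − ε| ‖φ‖ ‖u‖`, and vanishes when `E = ε`.

* `rankOne_eigen_sub_eq` — the eigen-equation as `T u − ε • u = −(μ ⟪v, u⟫) • v`;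
* `rankOne_secular_identity` — `(E − ε) * ⟪φ, u⟫ = −(μ * ⟪v, u⟫ * ⟪φ, v⟫)`;
* `abs_inner_eigenvector_update_le` — `|⟪φ, v⟫| * |μ * ⟪v, u⟫| ≤ |E − ε| * (‖φ‖ * ‖u‖)`;
* `inner_eigenvector_update_eq_zero` — `E = ε` and `μ ⟪v, u⟫ ≠ 0` imply `⟪φ, v⟫ = 0`.

No definitions, no named facts; no finite-dimensionality is assumed.
-/

noncomputable section

open scoped InnerProductSpace RealInnerProductSpace

namespace Literature.Analysis.InnerProduct

variable {E : Type*} [NormedAddCommGroup E] [InnerProductSpace ℝ E]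

/-- The eigen-equation of the rank-one update rewritten as a resolvent equation
`(T − ε) u = −(μ ⟪v, u⟫) v`. [folklore] -/
theorem rankOne_eigen_sub_eq (T : E →ₗ[ℝ] E) {u v : E} {μ ε : ℝ}
    (hu : T u + (μ * ⟪v, u⟫_ℝ) • v = ε • u) :
    T u - ε • u = -((μ * ⟪v, u⟫_ℝ) • v) := by
  rw [sub_eq_iff_eq_add, neg_add_eq_sub, eq_sub_iff_add_eq, hu]

/-- **Secular identity** for an eigenvector `u` of `T + μ|v⟩⟨v|` (eigenvalue `ε`) against an
eigenvector `φ` of the symmetric operator `T` (eigenvalue `E₁`):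
`(E₁ − ε) ⟪φ, u⟫ = −μ ⟪v, u⟫ ⟪φ, v⟫`. [cite: GolubVanLoan2013, Thm 8.4.3 (c) and proof] -/
theorem rankOne_secular_identity (T : E →ₗ[ℝ] E) (hsym : ∀ x y : E, ⟪T x, y⟫_ℝ = ⟪x, T y⟫_ℝ)
    {u v φ : E} {μ ε E₁ : ℝ} (hu : T u + (μ * ⟪v, u⟫_ℝ) • v = ε • u) (hφ : T φ = E₁ • φ) :
    (E₁ - ε) * ⟪φ, u⟫_ℝ = -(μ * ⟪v, u⟫_ℝ * ⟪φ, v⟫_ℝ) := by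
  have h1 : ⟪φ, T u + (μ * ⟪v, u⟫_ℝ) • v⟫_ℝ = ⟪φ, ε • u⟫_ℝ := by rw [hu]
  rw [inner_add_right, real_inner_smul_right, real_inner_smul_right, ← hsym φ u, hφ,
    real_inner_smul_left] at h1
  linarith

/-- **Near-orthogonality of the update vector to pinned eigenvectors**: with the notation of
`rankOne_secular_identity`, `|⟪φ, v⟫| · |μ ⟪v, u⟫| ≤ |E₁ − ε| ‖φ‖ ‖u‖`. In particular, when the
eigenvalue `E₁` of `T` is pinned close to the update eigenvalue `ε` and `μ ⟪v, u⟫` is of order one,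
the update vector is almost orthogonal to `φ`. [folklore] -/
theorem abs_inner_eigenvector_update_le (T : E →ₗ[ℝ] E)
    (hsym : ∀ x y : E, ⟪T x, y⟫_ℝ = ⟪x, T y⟫_ℝ) {u v φ : E} {μ ε E₁ : ℝ}
    (hu : T u + (μ * ⟪v, u⟫_ℝ) • v = ε • u) (hφ : T φ = E₁ • φ) :
    |⟪φ, v⟫_ℝ| * |μ * ⟪v, u⟫_ℝ| ≤ |E₁ - ε| * (‖φ‖ * ‖u‖) := by
  have h := rankOne_secular_identity T hsym hu hφ
  have hcs : |⟪φ, u⟫_ℝ| ≤ ‖φ‖ * ‖u‖ := abs_real_inner_le_norm φ u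
  have heq : |⟪φ, v⟫_ℝ| * |μ * ⟪v, u⟫_ℝ| = |E₁ - ε| * |⟪φ, u⟫_ℝ| := by
    rw [← abs_mul, ← abs_mul, mul_comm ⟪φ, v⟫_ℝ,
      show μ * ⟪v, u⟫_ℝ * ⟪φ, v⟫_ℝ = -((E₁ - ε) * ⟪φ, u⟫_ℝ) by linarith [h], abs_neg]
  rw [heq]
  exact mul_le_mul_of_nonneg_left hcs (abs_nonneg _)

/-- **Exact orthogonality at coincidence**: if an eigenvalue of `T` equals the update eigenvalue,
`E₁ = ε`, and the polar moment `μ ⟪v, u⟫` is nonzero, then `⟪φ, v⟫ = 0`. [folklore] -/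
theorem inner_eigenvector_update_eq_zero (T : E →ₗ[ℝ] E)
    (hsym : ∀ x y : E, ⟪T x, y⟫_ℝ = ⟪x, T y⟫_ℝ) {u v φ : E} {μ ε E₁ : ℝ}
    (hu : T u + (μ * ⟪v, u⟫_ℝ) • v = ε • u) (hφ : T φ = E₁ • φ) (hE : E₁ = ε)
    (hp : μ * ⟪v, u⟫_ℝ ≠ 0) : ⟪φ, v⟫_ℝ = 0 := by
  have h := rankOne_secular_identity T hsym hu hφ
  rw [hE, sub_self, zero_mul] at h
  have h0 : μ * ⟪v, u⟫_ℝ * ⟪φ, v⟫_ℝ = 0 := by linarith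
  rcases mul_eq_zero.mp h0 with h' | h'
  · exact absurd h' hp
  · exact h'

end Literature.Analysis.InnerProduct

end
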